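import Summits.ABC.IUTFork.Cor312LicenceExactContentM
import Summits.ABC.IUTFork.Cor312NotLicencePrVolSharpM
import HarnessLib

/-!
# [IUTchIII] Cor. 3.12, Step (xi-f): the licence / S_H at the M-level setting of the datum's OWN ideles, decided in terms of
# the q-idele norms `‖t_{q,v̲}‖` alone (`‖t_{Θ,j,v̲}‖ = ‖t_{q,v̲}‖^{j²}`) and the radii of the unit-log lattices

PROOF-ONLY record file (D-0012; no definitions, no `Prop` facts) of the abc-iut cell (WAVE-5 prover seat abc-iut-w5-d166, gen 6; D-0079
R-W lane U, row «W:M-LICENCE-EXACT», part 3: the instantiation of `Cor312LicenceExactContentM` (p459449) at the Θ-ideles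
`tOfIdeleData D r` / q-ideles `tqM … r` READ OFF a Θ-volume datum's idele data `r` (abc-iut-w5-d033), i.e. at the EXACT setting of the
M-line certificates of record — abc-iut-C-cert-3 `Conditional.abc_of_SH_v11M_window` p445989 / `…_szpiroBadAll` p453767 (binder `hSHw`),
`abc_of_SH_orNum_M_szpiroBad(_hregBad)` p451523 / p453684 (binder `hNumOffBad_M`), with `r := ideleDataOf T.D T.isVolumeInputOf`).
TAKES NO SIDE on [IUTchIII] Cor. 3.12 (kurims manuscript p. 173–174; Step (xi-f) p. 184) or on any author.

* `norm_labelIdele_tOfIdeleData` — at EVERY label `j ∈ {0,…,l⋆}`: `‖t_{Θ,j,v̲}‖ = ‖t_{q,v̲}‖^{j²}` (abc-iut-w5-d166 gen 5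
  `norm_tThetaM_eq_norm_tqM_pow`, Dupuy–Hilado (3.4) `P_{Θ,j} = j²·P_q`; the label `0` carries the idele `1`);
* **`forall_qRegion_subset_thetaHull_settingPrVolSharpM_tOfIdeleData_iff_radii`** — the BODY of S_H (every label, pinned `ρ = qRegion`,
  `Cor312Vol.pilotKummerCompatHull_const_iff`) at the own-ideles setting ⟺
  `∀ u j v⃗ m, (∀ a J, p_u^m·‖t_{q,v̲_a}‖^{j²} ≤ p_u^{−(d_I − d_{L_J})}·∏_b ρ_in(v̲_b)) → p_u^m·‖t_{q,v̲_j}‖ ≤ ∏_b ρ_out(v̲_b)`;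
* **`licence_settingPrVolSharpM_tOfIdeleData_iff_radii`** — `Thm311ToCor312.Licence` (labels `j = i+1 ∈ 𝔽_l^⋇`) ⟺ the same with `j = i+1`.
At a BAD member `v̲` the q-norm is `‖t_{q,v̲}‖ = p^{ord_v(j_E)/(2l·e_v)}` (abc-iut-w5-d166 gen 5 `norm_tqM_eq_rpow_ord_jMod`, `ord_v(j_E) < 0`),
at the other members `1` (abc-iut-w5-d033 `norm_tqM_eq_one_of_not_mem`) — so every M-line WINDOW-TABLE packet row is the displayed
integer/valuation test in (`ord_v(q_v)`, `e_v`, `l`, `d`, `ρ_in`, `ρ_out`); binder convention of abc-iut-c312-5 (`cin`: `hin0`/`hin`/`hmax`;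
`cout`: `houtΛ`/`hdom`). The unit set `S_q` and `htq1` of the setting do not enter the criterion.
HONEST SCOPE: the licence is a STRONGER-THAN-PRINT set-level reading of Step (xi-f) (ADJUDICATION-SPEC §2 (G1′)); OUR sharp containers and
typed (Ind1)/(Ind2)/(Ind3); nothing about the printed GLOBAL inequality or the NUMBER-level `Cor22.Cor312AtDatum`; refuted/inhabited-as-typed
≠ in print. [cite: Mochizuki2012, IUTchIII Cor. 3.12 p. 173–174, Step (xi-f) p. 184; IUTchI Def. 3.1 (e) p. 62, Ex. 3.2 (iv) p. 67]
[cite: DupuyHilado2025, §3.3, §3.4, §3.9, §4.9, §4.12] [claim: Mochizuki2012, status: disputed]. typed ≠ proved (these: proved).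
-/

noncomputable section

open Set Function NumberField IsDedekindDomain
open scoped Pointwise

namespace Summit.ABC.IUTFork.Thm311.Real

open Cor312 Cor312Vol Literature.IUT.LogThetaLattice Literature.IUT.LogVolume Literature.IUT.HodgeTheaters
  Literature.NumberTheory.NumberFields Literature.NumberTheory.GaloisRepresentations.Ultrametric

variable {F K Fbar : Type} [Field F] [NumberField F] [Field K] [NumberField K] [Algebra F K]
  [Field Fbar] [Algebra F Fbar] [Algebra K Fbar] {E : WeierstrassCurve F} [E.IsElliptic] {l : ℕ}
  {Pb : BadPlacePredicates K} (D : InitialThetaData F K Fbar E l Pb) {logvK : PadicLogsVal K}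
  (hlog : LogvAnalyticVal logvK) (r : ThetaData.IdeleData D)
  (M : Type) [Field M] [NumberField M]
  (archPk : ∀ (j : (thetaIndexOfInitial D).Label) (vQ : (thetaIndexOfInitial D).VQ),
    Set ((logShellsOfInitialDH D logvK).Packet j vQ))
  (archSub : ∀ (j : (thetaIndexOfInitial D).Label) (v : (thetaIndexOfInitial D).V),
    Set ((logShellsOfInitialDH D logvK).Packet j ((thetaIndexOfInitial D).over v)))
  (Ψ : ℤ → ∀ v : (thetaIndexOfInitial D).V, v ∈ (thetaIndexOfInitial D).Vbad →
    Set ((logShellsOfInitialDH D logvK).StarPacket v))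
  (act : ℤ → ∀ v : (thetaIndexOfInitial D).V, v ∈ (thetaIndexOfInitial D).Vbad →
    (logShellsOfInitialDH D logvK).StarPacket v → Module.End ℚ ((logShellsOfInitialDH D logvK).StarPacket v))
  (Mmod : ℤ → ∀ j : (thetaIndexOfInitial D).LabelStar, Set ((logShellsOfInitialDH D logvK).GlobalPacket j.1))
  (region : ℤ → ∀ j : (thetaIndexOfInitial D).LabelStar, FinDivisor M → ∀ vQ : (thetaIndexOfInitial D).VQ,
    Set ((logShellsOfInitialDH D logvK).Packet j.1 vQ))
  (n : ℤ) {HT : Type} {LogLink : HT → HT → Type} {IsFull : ∀ {s t : HT}, LogLink s t → Prop}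
  (lat : LGPGaussianLogThetaLattice LogLink IsFull)
  {Frd : Type} {IsoF : Frd → Frd → Type} {Ob : Frd → Type} {realify : Frd → Frd} {Strip : Type}
  {IsoS : Strip → Strip → Type}
  {Mv : ∀ v : (thetaIndexOfInitial D).V, v ∈ (thetaIndexOfInitial D).Vbad → Type} [∀ v h, Monoid (Mv v h)]
  (sig : GlobalLGPFrobenioidSignature (thetaIndexOfInitial D).lstar (thetaIndexOfInitial D).V
    (· ∈ (thetaIndexOfInitial D).Vbad) Frd IsoF Ob realify Strip IsoS Mv)
  (split : SplittingMonoids Mv) {ObΔ : Type}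
  {N : ∀ v : (thetaIndexOfInitial D).V, v ∈ (thetaIndexOfInitial D).Vbad → Type} [∀ v h, Monoid (N v h)]
  (qData : QPilotData ObΔ N)
  (htq0 : ∀ (u : FinitePlace ℚ) (x : (thetaIndexOfInitial D).Fibre (Val.non u)),
    tqM D (ratChar u) u (natCast_ratChar_mem u) r x ≠ 0)
  (Sq : Finset (FinitePlace ℚ))
  (htq1 : ∀ (u : FinitePlace ℚ) (x : (thetaIndexOfInitial D).Fibre (Val.non u)), u ∉ Sq →
    ‖tqM D (ratChar u) u (natCast_ratChar_mem u) r x‖ = 1)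
  (cin cout : ∀ (u : FinitePlace ℚ) (x : (thetaIndexOfInitial D).Fibre (Val.non u)),
    kOfM D (ratChar u) u (natCast_ratChar_mem u) x)
  (hin0 : ∀ u x, cin u x ≠ 0)
  (hin : ∀ u x (o : kOfM D (ratChar u) u (natCast_ratChar_mem u) x), ‖o‖ ≤ 1 →
    cin u x * o ∈ logUnits (kOfM D (ratChar u) u (natCast_ratChar_mem u) x))
  (hmax : ∀ u x, ∃ (ϖ : (kOfM D (ratChar u) u (natCast_ratChar_mem u) x)ˣ)
    (w : kOfM D (ratChar u) u (natCast_ratChar_mem u) x),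
    IsUniformizer ϖ ∧ w ∉ logUnits (kOfM D (ratChar u) u (natCast_ratChar_mem u) x) ∧
      ‖w‖ * ‖(ϖ : kOfM D (ratChar u) u (natCast_ratChar_mem u) x)‖ ≤ ‖cin u x‖)
  (houtΛ : ∀ u x, cout u x ∈ logUnits (kOfM D (ratChar u) u (natCast_ratChar_mem u) x))
  (hdom : ∀ u x, ∀ z ∈ logUnits (kOfM D (ratChar u) u (natCast_ratChar_mem u) x), ‖z‖ ≤ ‖cout u x‖)

/-- **`‖t_{Θ,j,v̲}‖ = ‖t_{q,v̲}‖^{j²}` at EVERY label** for the ideles read off the idele data `r` (label `0`: the idele `1`; label `i+1`: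
abc-iut-w5-d166 gen 5 `norm_tThetaM_eq_norm_tqM_pow`, Dupuy–Hilado (3.4)). [cite: DupuyHilado2025, §3.3, §3.4, §3.9] -/
theorem norm_labelIdele_tOfIdeleData (u : FinitePlace ℚ) (j : (thetaIndexOfInitial D).Label)
    (x : (thetaIndexOfInitial D).Fibre (Val.non u)) :
    ‖(presAtM D hlog u).labelIdele (tOfIdeleData D r u) j x‖ =
      ‖tqM D (ratChar u) u (natCast_ratChar_mem u) r x‖ ^ ((j : ℕ) ^ 2) := by
  unfold PadicPresentation.labelIdele
  split_ifs with h
  · rw [show ((j : ℕ) ^ 2) = (((j : ℕ) - 1) + 1) ^ 2 by congr 1; omega]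
    exact norm_tThetaM_eq_norm_tqM_pow D r (ratChar u) u (natCast_ratChar_mem u) _ x
  · rw [show (j : ℕ) = 0 by omega, norm_one]
    norm_num

include hin0 hin hmax houtΛ hdom in
/-- **THE BODY OF S_H AT THE OWN-IDELES M SETTING, decided** (every label, pinned `ρ = qRegion`;
`Cor312Vol.pilotKummerCompatHull_const_iff`): `∀ j v_ℚ, qRegion ⊆ ⁿ˒°𝒰_{j,v_ℚ}` ⟺ for every finite rational place `u`, label `j`, summand
`v⃗ : S^±_{j+1} → V̲_u` and `m ∈ ℤ`: (`∀ a J, p_u^m·‖t_{q,v̲_a}‖^{j²} ≤ p_u^{−(d_I − d_{L_J})}·∏_b ‖cin(v̲_b)‖`) `→ p_u^m·‖t_{q,v̲_j}‖ ≤ ∏_b ‖cout(v̲_b)‖`.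
[cite: Mochizuki2012, IUTchIII Cor. 3.12 Step (xi-d) p. 183, (xi-f) p. 184] [cite: DupuyHilado2025, §3.4, §3.9, §4.9, §4.12] -/
theorem forall_qRegion_subset_thetaHull_settingPrVolSharpM_tOfIdeleData_iff_radii :
    (∀ (j : (thetaIndexOfInitial D).Label) (vQ : (thetaIndexOfInitial D).VQ),
      (settingPrVolSharpM D hlog (tOfIdeleData D r) (fun u x => tqM D (ratChar u) u (natCast_ratChar_mem u) r x) M archPk archSub Ψ
          act Mmod region n lat sig split qData htq0 Sq htq1).qRegion j vQ ⊆
        (settingPrVolSharpM D hlog (tOfIdeleData D r) (fun u x => tqM D (ratChar u) u (natCast_ratChar_mem u) r x) M archPk archSub Ψ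
          act Mmod region n lat sig split qData htq0 Sq htq1).thetaHull j vQ) ↔
      ∀ (u : FinitePlace ℚ) (j : (thetaIndexOfInitial D).Label)
        (e : (thetaIndexOfInitial D).Caps j → (thetaIndexOfInitial D).Fibre (Val.non u)) (m : ℤ),
        (∀ (a : (thetaIndexOfInitial D).Caps j) (J : DIdx (ratChar u) ((presAtM D hlog u).kk e)),
          (ratChar u : ℝ) ^ m * ‖tqM D (ratChar u) u (natCast_ratChar_mem u) r (e a)‖ ^ ((j : ℕ) ^ 2) ≤
            (ratChar u : ℝ) ^ (-(dSum (ratChar u) ((presAtM D hlog u).kk e) -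
              differentOrd (ratChar u) (DFac (ratChar u) ((presAtM D hlog u).kk e) J))) * ∏ b, ‖cin u (e b)‖) →
        (ratChar u : ℝ) ^ m * ‖tqM D (ratChar u) u (natCast_ratChar_mem u) r (e (Fin.last _))‖ ≤ ∏ b, ‖cout u (e b)‖ := by
  rw [forall_qRegion_subset_thetaHull_settingPrVolSharpM_iff_radii D hlog (tOfIdeleData D r)
    (fun u x => tqM D (ratChar u) u (natCast_ratChar_mem u) r x) M archPk archSub Ψ act Mmod region n lat sig split qData htq0 Sq htq1
    (tOfIdeleData_ne_zero D r) cin cout hin0 hin hmax houtΛ hdom]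
  refine forall_congr' fun u => forall_congr' fun j => forall_congr' fun e => forall_congr' fun m => imp_congr ?_ Iff.rfl
  refine forall_congr' fun a => forall_congr' fun J => ?_
  rw [norm_labelIdele_tOfIdeleData D hlog r u j (e a)]

include hin0 hin hmax houtΛ hdom in
/-- **THE (xi-f) LICENCE AT THE OWN-IDELES M SETTING, decided** (labels `j = i+1 ∈ 𝔽_l^⋇`): `Thm311ToCor312.Licence` ⟺ for every `u`,
`i`, `v⃗ : S^±_{i+2} → V̲_u`, `m ∈ ℤ`: (`∀ a J, p_u^m·‖t_{q,v̲_a}‖^{(i+1)²} ≤ p_u^{−(d_I − d_{L_J})}·∏_b ‖cin(v̲_b)‖`) `→ p_u^m·‖t_{q,v̲_{i+1}}‖ ≤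
∏_b ‖cout(v̲_b)‖`. For the q-pinned reading this is the `hSHw` clause of the M-line certificates on `𝔽_l^⋇` (abc-iut-w5-d068
`licence_of_pilotKummerCompatHull`). [cite: Mochizuki2012, IUTchIII Cor. 3.12 p. 173–174, Step (xi-f) p. 184] [cite: DupuyHilado2025, §3.4, §4.12] -/
theorem licence_settingPrVolSharpM_tOfIdeleData_iff_radii :
    Thm311ToCor312.Licence
        (settingPrVolSharpM D hlog (tOfIdeleData D r) (fun u x => tqM D (ratChar u) u (natCast_ratChar_mem u) r x) M archPk archSub Ψ
          act Mmod region n lat sig split qData htq0 Sq htq1) ↔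
      ∀ (u : FinitePlace ℚ) (i : Fin (thetaIndexOfInitial D).lstar)
        (e : (thetaIndexOfInitial D).Caps (Setting.labelSucc i) → (thetaIndexOfInitial D).Fibre (Val.non u)) (m : ℤ),
        (∀ (a : (thetaIndexOfInitial D).Caps (Setting.labelSucc i))
            (J : DIdx (ratChar u) ((presAtM D hlog u).kk e)),
          (ratChar u : ℝ) ^ m * ‖tqM D (ratChar u) u (natCast_ratChar_mem u) r (e a)‖ ^ (((i : ℕ) + 1) ^ 2) ≤
            (ratChar u : ℝ) ^ (-(dSum (ratChar u) ((presAtM D hlog u).kk e) -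
              differentOrd (ratChar u) (DFac (ratChar u) ((presAtM D hlog u).kk e) J))) * ∏ b, ‖cin u (e b)‖) →
        (ratChar u : ℝ) ^ m * ‖tqM D (ratChar u) u (natCast_ratChar_mem u) r (e (Fin.last _))‖ ≤ ∏ b, ‖cout u (e b)‖ := by
  rw [licence_settingPrVolSharpM_iff_radii D hlog (tOfIdeleData D r)
    (fun u x => tqM D (ratChar u) u (natCast_ratChar_mem u) r x) M archPk archSub Ψ act Mmod region n lat sig split qData htq0 Sq htq1
    (tOfIdeleData_ne_zero D r) cin cout hin0 hin hmax houtΛ hdom]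
  refine forall_congr' fun u => forall_congr' fun i => forall_congr' fun e => forall_congr' fun m => imp_congr ?_ Iff.rfl
  refine forall_congr' fun a => forall_congr' fun J => ?_
  rw [show ‖tOfIdeleData D r u i (e a)‖ = ‖tqM D (ratChar u) u (natCast_ratChar_mem u) r (e a)‖ ^ (((i : ℕ) + 1) ^ 2) from
    norm_tThetaM_eq_norm_tqM_pow D r (ratChar u) u (natCast_ratChar_mem u) i (e a)]

end Summit.ABC.IUTFork.Thm311.Real

end
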